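import Summits.BirchSwinnertonDyer.BirchSwinnertonDyer.Theorems.AdditiveKolyvaginRoadLevelSystemsOfSeedCruxFree
import HarnessLib

/-!
# Route `AdditiveKolyvaginRoad`, crux `LevelKolyvaginSystemsAdditive` (item stmt-BirchSwinnertonDyer-21396, KS′):
# THE CLIMB — registered stub `stub_levelClimbOfIgnition` of line `additive_fibre_ignition`, PROVED
# (cell `pub/bsd-wall`, width seat `bsd-wall-akr-p2x-w3` g4; `--supports stmt-BirchSwinnertonDyer-21396`; namespace
# `…Theorems.AdditiveKoly`, same opens as the skeleton `Cruxes/LevelKolyvaginSystemsAdditive/Lines/additive_fibre_ignition.lean`)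

WHY. Line `additive_fibre_ignition` (crux-plan S1, 2026-08-28, skeleton 4edf65c24bf99b81) feeds the landed seed socket
`levelKolyvaginSystemsAdditive_of_seed_free` (p594553) with: K1 (the geometric bipartite datum, OPEN), the IGNITION (a Kolyvagin class
mod `p` detected above `p` at SOME conductor `m₀`, level `∅`; OPEN), and the m-DIRECTION TWIN carrying that class to the socket's seed
(conductor `∅`, a non-empty even level of total canonical rank `≤ 1`) — split into two E-side stubs: CLIMB (this file) and
`stub_kolyvaginRankOneVanishing` (Kolyvagin's triangulation, W. Zhang Lemma 8.4 (1); not here).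

WHAT.
* §1 `exists_admQ_notMem_torsionLocalKer_of_eigen` — signed Čebotarev for an ARBITRARY non-zero eigenclass of `H¹(K, E[p])`
  (the tree's `exists_admQ_notMem_torsionLocalKer` asks a Selmer class; the level-`∅` ignition class of conductor `m₀ ≠ ∅` is not
  Selmer — it is transverse at `m₀`); `finrank_add_finrank_insert_succ_of_detected` — the TOTAL canonical rank drops by one at a
  detected admissible prime (w2 g2's Poitou–Tate-free `selQP_lower_of_detected`, both signs booked).
* §2 over the abstract datum `(ε₀, κ₀, lam)` with its rows as hypotheses: `exists_minimal_conductor_ne_zero`, `mem_selQP_of_minimal`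
  (the class of minimal vanishing order at a non-empty even level is a canonical Selmer eigenclass — relation (8.1) above the
  conductor), **`exists_rankLeOne_level_of_ne_zero`** (THE CLIMB: two detecting primes per round lower the total rank by two while
  laws (A), (B) carry the non-zero class), `exists_level_pair_of_ne_zero_empty` (the first rung `∅ → {q, q'}`).
* §3 **`stub_levelClimbOfIgnition`** — the registered stub, VERBATIM signature: PUB → DUAL → ∀ ♯ frame, ∀ c ≠ 1, ∀ datum with its
  rows, `(∃ m₀, κ₀ m₀ ∅ ≠ 0) → ∃ n₀, n₀.Nonempty ∧ Even n₀.card ∧ finrank Sel_{n₀}⁺ + finrank Sel_{n₀}⁻ ≤ 1 ∧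
  ∃ m, κ₀ m n₀ ≠ 0`.

HONEST FRAMING: theorems only; 0 definitions, 0 named facts, 0 `sorry`; E-side (Čebotarev density for `ρ̄` onto, W. Zhang's
Poitou–Tate-free lowering Prop. 5.4, bookkeeping of the carrier `SelQP`); PUB ∕ DUAL are not used. It closes ONE of the six stubs
of the line; K1 and the ignition (the line's open content) and `stub_kolyvaginRankOneVanishing` are untouched. BSD is not proved by
any of this.

References: [cite: WZhang2014, Thm. 4.3, Prop. 5.4, Lemma 7.3, §8 (8.1), Lemma 8.4, Thm. 9.1] [cite: BertoliniDarmon2005, Thm. 3.2,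
Thm. 4.1, Thm. 4.2] [cite: Howard2006Bipartite, Cor. 2.3.5, Prop. 2.4.11] [cite: GrossLMS1991, Prop. 6.2, §5 (5.1)]. -/

-- single-conjunct summit: `Summit.BirchSwinnertonDyer.BirchSwinnertonDyer.…` repeats the name by design
set_option linter.dupNamespace false

noncomputable section

open scoped Classical

namespace Summit.BirchSwinnertonDyer.BirchSwinnertonDyer.Theorems.AdditiveKoly

open WeierstrassCurve NumberField IsDedekindDomain
  Literature.NumberTheory.EllipticCurves Literature.NumberTheory.EllipticCurves.ModularForms
  Literature.NumberTheory.EllipticCurves.Rank1Residual Literature.NumberTheory.GaloisRepresentations Module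
  Summit.BirchSwinnertonDyer.Rank1Residual.X11b.Three.Koly
  Summit.BirchSwinnertonDyer.BirchSwinnertonDyer.Theses.AdditiveKolyvaginRoad

variable (W : WeierstrassCurve ℚ) (K : Type) [Field K] [NumberField K] (p : ℕ) [W.IsElliptic] [W.IsGloballyMinimal]
  (c : K ≃ₐ[ℚ] K) [Module (ZMod p) (Vp W K p)]

/-! ## §1 Signed Čebotarev for an arbitrary eigenclass; the rank drop at a detected prime -/

omit [Module (ZMod p) (Vp W K p)] in
/-- **Signed Čebotarev for an ARBITRARY eigenclass** (W. Zhang Lemma 7.3 ∕ Bertolini–Darmon Thm. 3.2, LANDED as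
`Cheb.exists_admissible_loc_ne_zero`; here in `AdmQ` currency, WITHOUT the Selmer hypothesis of
`exists_admQ_notMem_torsionLocalKer`): at an additive `p ≥ 5` with `ρ̄_{E,p}` onto, `K` imaginary quadratic Heegner for `N_E`,
`c ≠ 1`, a non-zero `sgnP μ`-eigenclass of `H¹(K, E[p])` is detected above some admissible `q` outside any finite set `B`.
[cite: WZhang2014, Lemma 7.3] [cite: BertoliniDarmon2005, Thm. 3.2] -/
theorem exists_admQ_notMem_torsionLocalKer_of_eigen [Fact p.Prime] (h5 : 5 ≤ p) (hadd : Addv W p)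
    (hsurj : W.HasSurjectiveModNGaloisRep p) (hK : IsImaginaryQuadratic K)
    (hH : SatisfiesHeegnerHypothesis (W.conductorNorm ℤ) K) (hc1 : c ≠ 1) {μ : Bool} {x : Vp W K p}
    (hxμ : conjAct W c ((p ^ 1 : ℕ) : ℤ) x = sgnP μ • x) (hx0 : x ≠ 0) (B : Finset (AdmQ W K p)) :
    ∃ q : AdmQ W K p, q ∉ B ∧ ∃ v : HeightOneSpectrum (𝓞 K), ((q : ℕ) : 𝓞 K) ∈ v.asIdeal ∧
      x ∉ (W.baseChange K).torsionLocalKer (v.adicCompletion K) ((p ^ 1 : ℕ) : ℤ) := by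
  have hpp : p.Prime := Fact.out
  haveI : Fact (Nat.Prime (p ^ 1)) := ⟨by rw [pow_one]; exact hpp⟩
  have h5' : 5 ≤ p ^ 1 := by rw [pow_one]; exact h5
  have hpN : p ∣ W.conductorNorm ℤ := (W.dvd_conductorNorm_iff_not_hasGoodReductionAtPrime p).mpr hadd.1
  have hpN' : p ^ 1 ∣ W.conductorNorm ℤ := by rw [pow_one]; exact hpN
  have hsurj' : W.HasSurjectiveModNGaloisRep ((p ^ 1 : ℕ) : ℤ) := by rw [Nat.pow_one]; exact hsurj
  have hν : sgnP μ = 1 ∨ sgnP μ = -1 := by cases μ <;> simp [sgnP]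
  obtain ⟨q, hqB, hadm, v, hqv, hloc⟩ := Cheb.exists_admissible_loc_ne_zero W K (p := p ^ 1) h5' hK hsurj' hpN' hH
    hc1 hν hx0 hxμ (B.image Subtype.val)
  rw [Nat.pow_one] at hadm
  exact ⟨⟨q, hadm⟩, fun hqn ↦ hqB (Finset.mem_image.mpr ⟨⟨q, hadm⟩, hqn, rfl⟩), v, hqv, hloc⟩

/-- **The total canonical rank drops by one at a detected admissible prime** (W. Zhang Prop. 5.4, Poitou–Tate-free; w2 g2's
`selQP_lower_of_detected` read on the total rank: the detected sign loses one dimension, the other sign is inert).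
[cite: WZhang2014, Prop. 5.4, §9 (9.1)–(9.3)] [cite: Howard2006Bipartite, Cor. 2.3.5] -/
theorem finrank_add_finrank_insert_succ_of_detected [Fact p.Prime] (hK : IsImaginaryQuadratic K) (hpo : Odd p) (hc1 : c ≠ 1)
    {n : Finset (AdmQ W K p)} {q : AdmQ W K p} (hqn : q ∉ n) {μ : Bool} {x : Vp W K p}
    (hx : x ∈ SelQP W K p c n μ) {v : HeightOneSpectrum (𝓞 K)} (hv : ((q : ℕ) : 𝓞 K) ∈ v.asIdeal)
    (hxv : x ∉ (W.baseChange K).torsionLocalKer (v.adicCompletion K) ((p ^ 1 : ℕ) : ℤ)) :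
    finrank (ZMod p) (SelQP W K p c (insert q n) true) + finrank (ZMod p) (SelQP W K p c (insert q n) false) + 1 =
      finrank (ZMod p) (SelQP W K p c n true) + finrank (ZMod p) (SelQP W K p c n false) := by
  have hvx : (W.baseChange K).torsionLocMap (v.adicCompletion K) ((p ^ 1 : ℕ) : ℤ) x ≠ 0 :=
    fun h ↦ hxv (AddMonoidHom.mem_ker.mpr h)
  obtain ⟨-, hrank, -, hother⟩ := selQP_lower_of_detected W K p c hK hpo hc1 hqn hx hv hvx
  cases μ
  · rw [Bool.not_false] at hother
    rw [hother]; omega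
  · rw [Bool.not_true] at hother
    rw [hother]; omega

/-! ## §2 The climb over an abstract bipartite datum -/

section Climb

variable (ε₀ : Finset (AdmQ W K p) → Bool)
  (κ₀ : Finset {ℓ // Zhang2014.IsKolyvaginPrime (W.conductorNorm ℤ) W K p ℓ} → Finset (AdmQ W K p) → Vp W K p)
  (lam : Finset {ℓ // Zhang2014.IsKolyvaginPrime (W.conductorNorm ℤ) W K p ℓ} → Finset (AdmQ W K p) → ZMod p)

omit [W.IsElliptic] [Module (ZMod p) (Vp W K p)] in
/-- **A conductor of minimal vanishing order**: if some `κ₀ m n ≠ 0` then some `κ₀ m n ≠ 0` with `κ₀ (m ∖ ℓ) n = 0` for all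
`ℓ ∈ m` (induction on `#m`). [cite: WZhang2014, §8 (vanishing order)] -/
theorem exists_minimal_conductor_ne_zero (n : Finset (AdmQ W K p))
    (h : ∃ m : Finset {ℓ // Zhang2014.IsKolyvaginPrime (W.conductorNorm ℤ) W K p ℓ}, κ₀ m n ≠ 0) :
    ∃ m : Finset {ℓ // Zhang2014.IsKolyvaginPrime (W.conductorNorm ℤ) W K p ℓ}, κ₀ m n ≠ 0 ∧
      ∀ ℓ ∈ m, κ₀ (m.erase ℓ) n = 0 := by
  obtain ⟨m, hm⟩ := h
  -- strong induction on the size of the conductor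
  have key : ∀ k : ℕ, ∀ m : Finset {ℓ // Zhang2014.IsKolyvaginPrime (W.conductorNorm ℤ) W K p ℓ},
      m.card = k → κ₀ m n ≠ 0 →
      ∃ m' : Finset {ℓ // Zhang2014.IsKolyvaginPrime (W.conductorNorm ℤ) W K p ℓ}, κ₀ m' n ≠ 0 ∧
        ∀ ℓ ∈ m', κ₀ (m'.erase ℓ) n = 0 := by
    intro k
    induction k using Nat.strong_induction_on with
    | _ k ih =>
      intro m hmk hm
      by_cases hmin : ∀ ℓ ∈ m, κ₀ (m.erase ℓ) n = 0
      · exact ⟨m, hm, hmin⟩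
      · push Not at hmin
        obtain ⟨ℓ, hℓ, hne⟩ := hmin
        have hlt : (m.erase ℓ).card < k := by
          rw [Finset.card_erase_of_mem hℓ, ← hmk]
          exact Nat.sub_one_lt (Finset.card_ne_zero_of_mem hℓ)
        exact ih _ hlt (m.erase ℓ) rfl hne
  exact key m.card m rfl hm

omit [W.IsElliptic] in
/-- **The minimal-conductor class is a canonical Selmer eigenclass.** At a non-empty even level `n`, if `κ₀ (m ∖ ℓ) n = 0` for every
`ℓ ∈ m`, then `κ₀ m n ∈ Sel_n^{μ}`, `μ = ε₀ n · (−1)^{#m}`: the sign row gives the eigenvalue, `selmer_inf` ∕ `selmer_off` ∕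
`toric_on` the conditions away from `m`, and ABOVE a prime `ℓ ∈ m` the relation (8.1) with the vanishing class `κ₀ (m ∖ ℓ) n`
makes `κ₀ m n` locally TRIVIAL there (`torsionLocalKer ≤ selmerLocalKer`) — W. Zhang's "the class of minimal vanishing order is
Selmer". [cite: WZhang2014, §8 (8.1), Lemma 8.4, §9 (proof of Thm. 9.1)] [cite: GrossLMS1991, Prop. 6.2] -/
theorem mem_selQP_of_minimal [Fact p.Prime]
    (sign : ∀ n : Finset (AdmQ W K p), Even n.card →
      ∀ m : Finset {ℓ // Zhang2014.IsKolyvaginPrime (W.conductorNorm ℤ) W K p ℓ},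
      conjAct W c ((p ^ 1 : ℕ) : ℤ) (κ₀ m n) = sgnP (ε₀ n ^^ Nat.bodd m.card) • κ₀ m n)
    (selmer_off : ∀ n : Finset (AdmQ W K p), n.Nonempty → Even n.card →
      ∀ (m : Finset {ℓ // Zhang2014.IsKolyvaginPrime (W.conductorNorm ℤ) W K p ℓ}) (v : HeightOneSpectrum (𝓞 K)),
      (∀ ℓ ∈ m, ((ℓ : ℕ) : 𝓞 K) ∉ v.asIdeal) → (∀ q ∈ n, ((q : ℕ) : 𝓞 K) ∉ v.asIdeal) →
      κ₀ m n ∈ selmerLocalKer (W.baseChange K) (v.adicCompletion K) ((p ^ 1 : ℕ) : ℤ))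
    (selmer_inf : ∀ n : Finset (AdmQ W K p), n.Nonempty → Even n.card →
      ∀ (m : Finset {ℓ // Zhang2014.IsKolyvaginPrime (W.conductorNorm ℤ) W K p ℓ}) (w : InfinitePlace K),
      κ₀ m n ∈ selmerLocalKer (W.baseChange K) w.Completion ((p ^ 1 : ℕ) : ℤ))
    (toric_on : ∀ n : Finset (AdmQ W K p), n.Nonempty → Even n.card →
      ∀ m : Finset {ℓ // Zhang2014.IsKolyvaginPrime (W.conductorNorm ℤ) W K p ℓ}, ∀ q ∈ n,
      ∀ v : HeightOneSpectrum (𝓞 K),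
      ((q : ℕ) : 𝓞 K) ∈ v.asIdeal → κ₀ m n ∈ toricLocalKer (W.baseChange K) (v.adicCompletion K) ((p ^ 1 : ℕ) : ℤ))
    (relation : ∀ n : Finset (AdmQ W K p), n.Nonempty → Even n.card →
      ∀ (m : Finset {ℓ // Zhang2014.IsKolyvaginPrime (W.conductorNorm ℤ) W K p ℓ})
        (ℓ : {ℓ // Zhang2014.IsKolyvaginPrime (W.conductorNorm ℤ) W K p ℓ}), ℓ ∉ m → ∀ v : HeightOneSpectrum (𝓞 K),
      ((ℓ : ℕ) : 𝓞 K) ∈ v.asIdeal →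
      (κ₀ (insert ℓ m) n ∈ (W.baseChange K).torsionLocalKer (v.adicCompletion K) ((p ^ 1 : ℕ) : ℤ) ↔
        κ₀ m n ∈ (W.baseChange K).torsionLocalKer (v.adicCompletion K) ((p ^ 1 : ℕ) : ℤ)))
    {n : Finset (AdmQ W K p)} (hn : n.Nonempty) (hne : Even n.card)
    {m : Finset {ℓ // Zhang2014.IsKolyvaginPrime (W.conductorNorm ℤ) W K p ℓ}} (hmin : ∀ ℓ ∈ m, κ₀ (m.erase ℓ) n = 0) :
    κ₀ m n ∈ SelQP W K p c n (ε₀ n ^^ Nat.bodd m.card) := by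
  refine (mem_selQP_iff W K p c n _ _).mpr ⟨sign n hne m, selmer_inf n hn hne m, fun v hv ↦ ?_, fun q hq v hqv ↦ ?_⟩
  · by_cases hm : ∀ ℓ ∈ m, ((ℓ : ℕ) : 𝓞 K) ∉ v.asIdeal
    · exact selmer_off n hn hne m v hm hv
    · push Not at hm
      obtain ⟨ℓ, hℓ, hℓv⟩ := hm
      -- above a prime of the conductor: locally trivial by the relation with the (vanishing) class one conductor down
      have hrel := relation n hn hne (m.erase ℓ) ℓ (Finset.notMem_erase ℓ m) v hℓv
      rw [Finset.insert_erase hℓ] at hrel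
      have htriv : κ₀ m n ∈ (W.baseChange K).torsionLocalKer (v.adicCompletion K) ((p ^ 1 : ℕ) : ℤ) := by
        rw [hrel, hmin ℓ hℓ]
        exact AddSubgroup.zero_mem _
      exact (W.baseChange K).torsionLocalKer_le_selmerLocalKer (v.adicCompletion K) _ htriv
  · exact toric_on n hn hne m q hq v hqv

/-- **THE CLIMB** (W. Zhang Thm. 9.1's walk, run UPWARD; E-side over the abstract bipartite datum). At a ♯ additive frame, from a
non-empty even level `n` carrying a non-zero class `κ₀ m n` one reaches a non-empty even level `n₀` of total canonical rank `≤ 1`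
carrying a non-zero class: while the total rank is `≥ 2`, the minimal-conductor class is a Selmer eigenclass
(`mem_selQP_of_minimal`); an admissible `q` detecting it (signed Čebotarev) LOWERS the total rank by one
(`finrank_add_finrank_insert_succ_of_detected`) and makes `lam m (n ∪ q)` a unit (law (A)); an admissible `q'` detecting a non-zero
Selmer eigenclass of the odd level `n ∪ q` lowers the rank again, and law (B) keeps `κ₀ m (n ∪ {q, q'})` non-zero; induction on
the total rank. [cite: WZhang2014, Thm. 9.1 (proof, pp. 240–242), Prop. 5.4, Lemma 7.3, Thm. 4.3]
[cite: BertoliniDarmon2005, Thm. 3.2, Thm. 4.1, Thm. 4.2] [cite: Howard2006Bipartite, Cor. 2.3.5] -/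
theorem exists_rankLeOne_level_of_ne_zero [Fact p.Prime] (h5 : 5 ≤ p) (hadd : Addv W p) (hsurj : W.HasSurjectiveModNGaloisRep p)
    (hK : IsImaginaryQuadratic K) (hH : SatisfiesHeegnerHypothesis (W.conductorNorm ℤ) K) (hc1 : c ≠ 1)
    (sign : ∀ n : Finset (AdmQ W K p), Even n.card →
      ∀ m : Finset {ℓ // Zhang2014.IsKolyvaginPrime (W.conductorNorm ℤ) W K p ℓ},
      conjAct W c ((p ^ 1 : ℕ) : ℤ) (κ₀ m n) = sgnP (ε₀ n ^^ Nat.bodd m.card) • κ₀ m n)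
    (selmer_off : ∀ n : Finset (AdmQ W K p), n.Nonempty → Even n.card →
      ∀ (m : Finset {ℓ // Zhang2014.IsKolyvaginPrime (W.conductorNorm ℤ) W K p ℓ}) (v : HeightOneSpectrum (𝓞 K)),
      (∀ ℓ ∈ m, ((ℓ : ℕ) : 𝓞 K) ∉ v.asIdeal) → (∀ q ∈ n, ((q : ℕ) : 𝓞 K) ∉ v.asIdeal) →
      κ₀ m n ∈ selmerLocalKer (W.baseChange K) (v.adicCompletion K) ((p ^ 1 : ℕ) : ℤ))
    (selmer_inf : ∀ n : Finset (AdmQ W K p), n.Nonempty → Even n.card →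
      ∀ (m : Finset {ℓ // Zhang2014.IsKolyvaginPrime (W.conductorNorm ℤ) W K p ℓ}) (w : InfinitePlace K),
      κ₀ m n ∈ selmerLocalKer (W.baseChange K) w.Completion ((p ^ 1 : ℕ) : ℤ))
    (toric_on : ∀ n : Finset (AdmQ W K p), n.Nonempty → Even n.card →
      ∀ m : Finset {ℓ // Zhang2014.IsKolyvaginPrime (W.conductorNorm ℤ) W K p ℓ}, ∀ q ∈ n,
      ∀ v : HeightOneSpectrum (𝓞 K),
      ((q : ℕ) : 𝓞 K) ∈ v.asIdeal → κ₀ m n ∈ toricLocalKer (W.baseChange K) (v.adicCompletion K) ((p ^ 1 : ℕ) : ℤ))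
    (relation : ∀ n : Finset (AdmQ W K p), n.Nonempty → Even n.card →
      ∀ (m : Finset {ℓ // Zhang2014.IsKolyvaginPrime (W.conductorNorm ℤ) W K p ℓ})
        (ℓ : {ℓ // Zhang2014.IsKolyvaginPrime (W.conductorNorm ℤ) W K p ℓ}), ℓ ∉ m → ∀ v : HeightOneSpectrum (𝓞 K),
      ((ℓ : ℕ) : 𝓞 K) ∈ v.asIdeal →
      (κ₀ (insert ℓ m) n ∈ (W.baseChange K).torsionLocalKer (v.adicCompletion K) ((p ^ 1 : ℕ) : ℤ) ↔
        κ₀ m n ∈ (W.baseChange K).torsionLocalKer (v.adicCompletion K) ((p ^ 1 : ℕ) : ℤ)))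
    (lawA : ∀ (n : Finset (AdmQ W K p)) (q : AdmQ W K p), Even n.card → q ∉ n →
      ∀ m : Finset {ℓ // Zhang2014.IsKolyvaginPrime (W.conductorNorm ℤ) W K p ℓ},
      lam m (insert q n) ≠ 0 ↔ ∃ v : HeightOneSpectrum (𝓞 K), ((q : ℕ) : 𝓞 K) ∈ v.asIdeal ∧
        κ₀ m n ∉ (W.baseChange K).torsionLocalKer (v.adicCompletion K) ((p ^ 1 : ℕ) : ℤ))
    (lawB : ∀ (n : Finset (AdmQ W K p)) (q : AdmQ W K p), Odd n.card → q ∉ n →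
      ∀ m : Finset {ℓ // Zhang2014.IsKolyvaginPrime (W.conductorNorm ℤ) W K p ℓ},
      (∃ v : HeightOneSpectrum (𝓞 K), ((q : ℕ) : 𝓞 K) ∈ v.asIdeal ∧
        κ₀ m (insert q n) ∉ (W.baseChange K).torsionLocalKer (v.adicCompletion K) ((p ^ 1 : ℕ) : ℤ)) ↔ lam m n ≠ 0)
    {n : Finset (AdmQ W K p)} (hn : n.Nonempty) (hne : Even n.card)
    (hκ : ∃ m : Finset {ℓ // Zhang2014.IsKolyvaginPrime (W.conductorNorm ℤ) W K p ℓ}, κ₀ m n ≠ 0) :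
    ∃ n₀ : Finset (AdmQ W K p), n₀.Nonempty ∧ Even n₀.card ∧
      finrank (ZMod p) (SelQP W K p c n₀ true) + finrank (ZMod p) (SelQP W K p c n₀ false) ≤ 1 ∧
      ∃ m : Finset {ℓ // Zhang2014.IsKolyvaginPrime (W.conductorNorm ℤ) W K p ℓ}, κ₀ m n₀ ≠ 0 := by
  have hpo : Odd p := (Fact.out : p.Prime).odd_of_ne_two (by omega)
  -- strong induction on the total canonical rank of the level
  suffices key : ∀ (r : ℕ) (n : Finset (AdmQ W K p)), n.Nonempty → Even n.card →
      finrank (ZMod p) (SelQP W K p c n true) + finrank (ZMod p) (SelQP W K p c n false) = r →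
      (∃ m : Finset {ℓ // Zhang2014.IsKolyvaginPrime (W.conductorNorm ℤ) W K p ℓ}, κ₀ m n ≠ 0) →
      ∃ n₀ : Finset (AdmQ W K p), n₀.Nonempty ∧ Even n₀.card ∧
        finrank (ZMod p) (SelQP W K p c n₀ true) + finrank (ZMod p) (SelQP W K p c n₀ false) ≤ 1 ∧
        ∃ m : Finset {ℓ // Zhang2014.IsKolyvaginPrime (W.conductorNorm ℤ) W K p ℓ}, κ₀ m n₀ ≠ 0 from
    key _ n hn hne rfl hκ
  intro r
  induction r using Nat.strong_induction_on with
  | _ r ih =>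
    intro n hn hne hr hκ
    by_cases hle : r ≤ 1
    · exact ⟨n, hn, hne, hr ▸ hle, hκ⟩
    · -- total rank ≥ 2: two detecting admissible primes lower it by two and carry the class along
      obtain ⟨m, hm0, hmin⟩ := exists_minimal_conductor_ne_zero W K p κ₀ n hκ
      have hx : κ₀ m n ∈ SelQP W K p c n (ε₀ n ^^ Nat.bodd m.card) :=
        mem_selQP_of_minimal W K p c ε₀ κ₀ sign selmer_off selmer_inf toric_on relation hn hne hmin
      -- first prime: detects the minimal class (signed Čebotarev), lowers the rank, law (A) gives a unit value
      obtain ⟨q, hqn, v, hv, hxv⟩ := exists_admQ_notMem_torsionLocalKer W K p c h5 hadd hsurj hK hH hc1 hx hm0 n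
      have hr₁ := finrank_add_finrank_insert_succ_of_detected W K p c hK hpo hc1 hqn hx hv hxv
      have hunit : lam m (insert q n) ≠ 0 := (lawA n q hne hqn m).mpr ⟨v, hv, hxv⟩
      -- a non-zero Selmer eigenclass at the odd level `n ∪ q` (its total rank is `r - 1 ≥ 1`)
      set n₁ := insert q n with hn₁
      have hr₁' : finrank (ZMod p) (SelQP W K p c n₁ true) + finrank (ZMod p) (SelQP W K p c n₁ false) = r - 1 := by
        omega
      obtain ⟨μ, y, hy, hy0⟩ : ∃ (μ : Bool) (y : Vp W K p), y ∈ SelQP W K p c n₁ μ ∧ y ≠ 0 := by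
        by_cases ht : finrank (ZMod p) (SelQP W K p c n₁ true) = 0
        · have hf : 0 < finrank (ZMod p) (SelQP W K p c n₁ false) := by omega
          have hnb : SelQP W K p c n₁ false ≠ ⊥ := by intro hbot; rw [hbot, finrank_bot] at hf; exact lt_irrefl 0 hf
          obtain ⟨y, hy, hy0⟩ := Submodule.exists_mem_ne_zero_of_ne_bot hnb
          exact ⟨false, y, hy, hy0⟩
        · have hf : 0 < finrank (ZMod p) (SelQP W K p c n₁ true) := Nat.pos_of_ne_zero ht
          have hnb : SelQP W K p c n₁ true ≠ ⊥ := by intro hbot; rw [hbot, finrank_bot] at hf; exact lt_irrefl 0 hf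
          obtain ⟨y, hy, hy0⟩ := Submodule.exists_mem_ne_zero_of_ne_bot hnb
          exact ⟨true, y, hy, hy0⟩
      -- second prime: detects `y`, lowers the rank again; law (B) keeps the class non-zero
      obtain ⟨q', hq'n₁, v', hv', hyv'⟩ := exists_admQ_notMem_torsionLocalKer W K p c h5 hadd hsurj hK hH hc1 hy hy0 n₁
      have hr₂ := finrank_add_finrank_insert_succ_of_detected W K p c hK hpo hc1 hq'n₁ hy hv' hyv'
      have hodd₁ : Odd n₁.card := by
        rw [hn₁, Finset.card_insert_of_notMem hqn]; exact hne.add_one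
      obtain ⟨v'', -, hdet⟩ := (lawB n₁ q' hodd₁ hq'n₁ m).mpr hunit
      have hκ₂ : κ₀ m (insert q' n₁) ≠ 0 := fun h0 ↦ hdet (by rw [h0]; exact AddSubgroup.zero_mem _)
      have hne₂ : Even (insert q' n₁).card := by
        rw [Finset.card_insert_of_notMem hq'n₁]; exact hodd₁.add_one
      have hlt : finrank (ZMod p) (SelQP W K p c (insert q' n₁) true) +
          finrank (ZMod p) (SelQP W K p c (insert q' n₁) false) < r := by omega
      exact ih _ hlt (insert q' n₁) (Finset.insert_nonempty q' n₁) hne₂ rfl ⟨m, hκ₂⟩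

omit [Module (ZMod p) (Vp W K p)] in
/-- **The first rung: from level `∅` to a two-prime level.** If `κ₀ m₀ ∅ ≠ 0` (an eigenclass by the sign row at `∅`), a
Bertolini–Darmon admissible `q` detects it (Čebotarev, `Cheb.exists_admissible_loc_ne_zero`), so `lam m₀ {q}` is a unit by law (A)
at `∅`; for any further admissible `q' ≠ q`, law (B) at the odd level `{q}` makes `κ₀ m₀ {q, q'}` detected above `q'`, hence
non-zero. [cite: WZhang2014, Thm. 4.3, Lemma 7.3, §9] [cite: BertoliniDarmon2005, Thm. 3.2, Thm. 4.1, Thm. 4.2] -/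
theorem exists_level_pair_of_ne_zero_empty [Fact p.Prime] (h5 : 5 ≤ p) (hadd : Addv W p) (hsurj : W.HasSurjectiveModNGaloisRep p)
    (hK : IsImaginaryQuadratic K) (hH : SatisfiesHeegnerHypothesis (W.conductorNorm ℤ) K) (hc1 : c ≠ 1)
    (sign : ∀ n : Finset (AdmQ W K p), Even n.card →
      ∀ m : Finset {ℓ // Zhang2014.IsKolyvaginPrime (W.conductorNorm ℤ) W K p ℓ},
      conjAct W c ((p ^ 1 : ℕ) : ℤ) (κ₀ m n) = sgnP (ε₀ n ^^ Nat.bodd m.card) • κ₀ m n)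
    (lawA : ∀ (n : Finset (AdmQ W K p)) (q : AdmQ W K p), Even n.card → q ∉ n →
      ∀ m : Finset {ℓ // Zhang2014.IsKolyvaginPrime (W.conductorNorm ℤ) W K p ℓ},
      lam m (insert q n) ≠ 0 ↔ ∃ v : HeightOneSpectrum (𝓞 K), ((q : ℕ) : 𝓞 K) ∈ v.asIdeal ∧
        κ₀ m n ∉ (W.baseChange K).torsionLocalKer (v.adicCompletion K) ((p ^ 1 : ℕ) : ℤ))
    (lawB : ∀ (n : Finset (AdmQ W K p)) (q : AdmQ W K p), Odd n.card → q ∉ n →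
      ∀ m : Finset {ℓ // Zhang2014.IsKolyvaginPrime (W.conductorNorm ℤ) W K p ℓ},
      (∃ v : HeightOneSpectrum (𝓞 K), ((q : ℕ) : 𝓞 K) ∈ v.asIdeal ∧
        κ₀ m (insert q n) ∉ (W.baseChange K).torsionLocalKer (v.adicCompletion K) ((p ^ 1 : ℕ) : ℤ)) ↔ lam m n ≠ 0)
    {m₀ : Finset {ℓ // Zhang2014.IsKolyvaginPrime (W.conductorNorm ℤ) W K p ℓ}} (hm₀ : κ₀ m₀ ∅ ≠ 0) :
    ∃ n₁ : Finset (AdmQ W K p), n₁.Nonempty ∧ Even n₁.card ∧ κ₀ m₀ n₁ ≠ 0 := by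
  -- an admissible prime detecting the eigenclass `κ₀ m₀ ∅`
  have hsgn := sign ∅ (by simp) m₀
  obtain ⟨q, -, v, hv, hxv⟩ :=
    exists_admQ_notMem_torsionLocalKer_of_eigen W K p c h5 hadd hsurj hK hH hc1 hsgn hm₀ ∅
  -- law (A) at level `∅`: the value at `{q}` is a unit
  have hunit : lam m₀ (insert q ∅) ≠ 0 := (lawA ∅ q (by simp) (Finset.notMem_empty q) m₀).mpr ⟨v, hv, hxv⟩
  -- any second admissible prime; law (B) at `{q}` keeps the class non-zero at `{q', q}`
  obtain ⟨q', hq', -⟩ :=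
    exists_admQ_notMem_torsionLocalKer_of_eigen W K p c h5 hadd hsurj hK hH hc1 hsgn hm₀ (insert q ∅)
  have hodd : Odd (insert q (∅ : Finset (AdmQ W K p))).card := by
    rw [Finset.card_insert_of_notMem (Finset.notMem_empty q), Finset.card_empty]; exact odd_one
  obtain ⟨v', -, hdet⟩ := (lawB (insert q ∅) q' hodd hq' m₀).mpr hunit
  refine ⟨insert q' (insert q ∅), Finset.insert_nonempty _ _, ?_, fun h0 ↦ hdet (by rw [h0]; exact AddSubgroup.zero_mem _)⟩
  rw [Finset.card_insert_of_notMem hq']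
  exact hodd.add_one

end Climb

/-! ## §3 The registered stub `stub_levelClimbOfIgnition` of line `additive_fibre_ignition` -/

/-- **`stub_levelClimbOfIgnition` — the registered stub CLIMB of line `additive_fibre_ignition` (crux-plan S1, skeleton
`Cruxes/LevelKolyvaginSystemsAdditive/Lines/additive_fibre_ignition.lean`), VERBATIM signature, PROVED.** Over the abstract bipartite
datum (signs at every even level incl. `∅`, Kummer ∕ archimedean ∕ toric rows and the relation (8.1) at non-empty even levels, the
Bertolini–Darmon laws (A), (B) two-sided), at a ♯ additive frame: a non-zero class `κ₀ m₀ ∅` at level `∅` of ANY Kolyvagin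
conductor (the ignition, or `c(1) ≢ 0` itself) propagates UP the admissible levels to a NON-EMPTY EVEN level of total canonical
rank `≤ 1` carrying a non-zero class of some conductor. Proof: the first rung `exists_level_pair_of_ne_zero_empty` then the climb
`exists_rankLeOne_level_of_ne_zero`. PUB ∕ DUAL, `realisation`, `transverse_on` and most frame binders are idle (kept so that the
statement is the registered text). E-side; closes nothing by itself (the line's OPEN stubs are K1 and the ignition); BSD is not
proved by this. [cite: WZhang2014, Thm. 9.1, Prop. 5.4, Lemma 7.3, Thm. 4.3, §8 (8.1)] [cite: BertoliniDarmon2005, Thm. 3.2,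
Thm. 4.1, Thm. 4.2] [cite: Howard2006Bipartite, Cor. 2.3.5] -/
theorem stub_levelClimbOfIgnition :
    PublishedInputsAdditiveKoly → PublishedDualityInputsAdditiveKoly →
    ∀ (W : WeierstrassCurve ℚ) [W.IsElliptic] [W.IsGloballyMinimal] [NeZero (W.conductorNorm ℤ)]
      (p : ℕ) [Fact p.Prime] (K : Type) [Field K] [NumberField K]
      (Dt : ModularParametrizationData W (W.conductorNorm ℤ)) (β : ℤ) (ι : K →+* ℂ),
      5 ≤ p → Addv W p → W.HasSurjectiveModNGaloisRep p →
      (∀ (ℓ : ℕ) [Fact ℓ.Prime], W.HasMultiplicativeReductionAtPrime ℓ →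
        ¬ p ∣ padicValInt ℓ W.minimalDiscriminantInt) →
      (∃ (ℓ₁ ℓ₂ : ℕ) (_ : Fact ℓ₁.Prime) (_ : Fact ℓ₂.Prime), ℓ₁ ≠ ℓ₂ ∧
        W.HasMultiplicativeReductionAtPrime ℓ₁ ∧ W.HasMultiplicativeReductionAtPrime ℓ₂) →
      ¬ p ∣ W.tamagawaProduct → W.analyticRank = 1 →
      IsImaginaryQuadratic K → Odd (NumberField.discr K) → NumberField.discr K < -4 →
      SatisfiesHeegnerHypothesis (W.conductorNorm ℤ) K →
      (W.quadraticTwist (NumberField.discr K : ℚ)).entireLFunction 1 ≠ 0 →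
      (4 * (W.conductorNorm ℤ : ℤ)) ∣ β ^ 2 - NumberField.discr K → ¬ (p : ℤ) ∣ Dt.c →
      ∀ (c : K ≃ₐ[ℚ] K), c ≠ 1 → ∀ [Module (ZMod p) (Vp W K p)],
      ∀ (ε₀ : Finset (AdmQ W K p) → Bool)
        (κ₀ : Finset {ℓ // Zhang2014.IsKolyvaginPrime (W.conductorNorm ℤ) W K p ℓ} → Finset (AdmQ W K p) → Vp W K p)
        (lam : Finset {ℓ // Zhang2014.IsKolyvaginPrime (W.conductorNorm ℤ) W K p ℓ} → Finset (AdmQ W K p) → ZMod p),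
        -- realisation at level `∅`: the classes ARE the frame's Kolyvagin classes mod `p`
        (∀ m : Finset {ℓ // Zhang2014.IsKolyvaginPrime (W.conductorNorm ℤ) W K p ℓ},
          ∃ d : KolyvaginHeegnerData Dt β ι (∏ ℓ ∈ m, (ℓ : ℕ)), κ₀ m ∅ = d.kolyvaginClass (Fact.out : p.Prime) 1) →
        -- sign at EVERY even level, `∅` included (Gross Prop. 5.4 (2) at level `∅`; the socket's row is the `n.Nonempty` restriction)
        (∀ n : Finset (AdmQ W K p), Even n.card →
          ∀ m : Finset {ℓ // Zhang2014.IsKolyvaginPrime (W.conductorNorm ℤ) W K p ℓ},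
          conjAct W c ((p ^ 1 : ℕ) : ℤ) (κ₀ m n) = sgnP (ε₀ n ^^ Nat.bodd m.card) • κ₀ m n) →
        -- selmer_off
        (∀ n : Finset (AdmQ W K p), n.Nonempty → Even n.card →
          ∀ (m : Finset {ℓ // Zhang2014.IsKolyvaginPrime (W.conductorNorm ℤ) W K p ℓ}) (v : HeightOneSpectrum (𝓞 K)),
          (∀ ℓ ∈ m, ((ℓ : ℕ) : 𝓞 K) ∉ v.asIdeal) → (∀ q ∈ n, ((q : ℕ) : 𝓞 K) ∉ v.asIdeal) →
          κ₀ m n ∈ selmerLocalKer (W.baseChange K) (v.adicCompletion K) ((p ^ 1 : ℕ) : ℤ)) →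
        -- selmer_inf
        (∀ n : Finset (AdmQ W K p), n.Nonempty → Even n.card →
          ∀ (m : Finset {ℓ // Zhang2014.IsKolyvaginPrime (W.conductorNorm ℤ) W K p ℓ}) (w : InfinitePlace K),
          κ₀ m n ∈ selmerLocalKer (W.baseChange K) w.Completion ((p ^ 1 : ℕ) : ℤ)) →
        -- toric_on
        (∀ n : Finset (AdmQ W K p), n.Nonempty → Even n.card →
          ∀ m : Finset {ℓ // Zhang2014.IsKolyvaginPrime (W.conductorNorm ℤ) W K p ℓ}, ∀ q ∈ n,
          ∀ v : HeightOneSpectrum (𝓞 K), ((q : ℕ) : 𝓞 K) ∈ v.asIdeal →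
          κ₀ m n ∈ toricLocalKer (W.baseChange K) (v.adicCompletion K) ((p ^ 1 : ℕ) : ℤ)) →
        -- transverse_on
        (∀ n : Finset (AdmQ W K p), n.Nonempty → Even n.card →
          ∀ m : Finset {ℓ // Zhang2014.IsKolyvaginPrime (W.conductorNorm ℤ) W K p ℓ}, ∀ ℓ ∈ m,
          ∀ v : HeightOneSpectrum (𝓞 K), ((ℓ : ℕ) : 𝓞 K) ∈ v.asIdeal → κ₀ m n ∈ transverseLocalKerP W K p ι ℓ v) →
        -- relation (8.1)
        (∀ n : Finset (AdmQ W K p), n.Nonempty → Even n.card →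
          ∀ (m : Finset {ℓ // Zhang2014.IsKolyvaginPrime (W.conductorNorm ℤ) W K p ℓ})
            (ℓ : {ℓ // Zhang2014.IsKolyvaginPrime (W.conductorNorm ℤ) W K p ℓ}), ℓ ∉ m →
          ∀ v : HeightOneSpectrum (𝓞 K), ((ℓ : ℕ) : 𝓞 K) ∈ v.asIdeal →
          (κ₀ (insert ℓ m) n ∈ (W.baseChange K).torsionLocalKer (v.adicCompletion K) ((p ^ 1 : ℕ) : ℤ) ↔
            κ₀ m n ∈ (W.baseChange K).torsionLocalKer (v.adicCompletion K) ((p ^ 1 : ℕ) : ℤ))) →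
        -- law (A), TWO-SIDED: the value one level up is a unit iff the class is detected at the NEW prime
        (∀ (n : Finset (AdmQ W K p)) (q : AdmQ W K p), Even n.card → q ∉ n →
          ∀ m : Finset {ℓ // Zhang2014.IsKolyvaginPrime (W.conductorNorm ℤ) W K p ℓ},
          lam m (insert q n) ≠ 0 ↔ ∃ v : HeightOneSpectrum (𝓞 K), ((q : ℕ) : 𝓞 K) ∈ v.asIdeal ∧
            κ₀ m n ∉ (W.baseChange K).torsionLocalKer (v.adicCompletion K) ((p ^ 1 : ℕ) : ℤ)) →
        -- law (B), TWO-SIDED: the class is detected at a LEVEL prime iff the value one level down is a unit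
        (∀ (n : Finset (AdmQ W K p)) (q : AdmQ W K p), Odd n.card → q ∉ n →
          ∀ m : Finset {ℓ // Zhang2014.IsKolyvaginPrime (W.conductorNorm ℤ) W K p ℓ},
          (∃ v : HeightOneSpectrum (𝓞 K), ((q : ℕ) : 𝓞 K) ∈ v.asIdeal ∧
            κ₀ m (insert q n) ∉ (W.baseChange K).torsionLocalKer (v.adicCompletion K) ((p ^ 1 : ℕ) : ℤ)) ↔
            lam m n ≠ 0) →
        -- a non-zero class at level `∅`, ANY Kolyvagin conductor (the ignition, or `c(1) ≠ 0` itself)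
        (∃ m₀ : Finset {ℓ // Zhang2014.IsKolyvaginPrime (W.conductorNorm ℤ) W K p ℓ}, κ₀ m₀ ∅ ≠ 0) →
        ∃ n₀ : Finset (AdmQ W K p), n₀.Nonempty ∧ Even n₀.card ∧
          finrank (ZMod p) (SelQP W K p c n₀ true) + finrank (ZMod p) (SelQP W K p c n₀ false) ≤ 1 ∧
          ∃ m : Finset {ℓ // Zhang2014.IsKolyvaginPrime (W.conductorNorm ℤ) W K p ℓ}, κ₀ m n₀ ≠ 0 := by
  intro _ _ W _ _ _ p _ K _ _ Dt β ι h5 hadd hsurj _ _ _ _ hK _ _ hH _ _ _ c hc1 _ ε₀ κ₀ lam _ sign selmer_off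
    selmer_inf toric_on _ relation lawA lawB hign
  obtain ⟨m₀, hm₀⟩ := hign
  obtain ⟨n₁, hn₁, hne₁, hκ₁⟩ :=
    exists_level_pair_of_ne_zero_empty W K p c ε₀ κ₀ lam h5 hadd hsurj hK hH hc1 sign lawA lawB hm₀
  exact exists_rankLeOne_level_of_ne_zero W K p c ε₀ κ₀ lam h5 hadd hsurj hK hH hc1 sign selmer_off selmer_inf toric_on
    relation lawA lawB hn₁ hne₁ ⟨m₀, hκ₁⟩

end Summit.BirchSwinnertonDyer.BirchSwinnertonDyer.Theorems.AdditiveKoly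

end
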